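import HarnessLib
import Literature.Computability.AlgebraicComplexity.GKKSDepthFourProofs

/-!
# Strictness of the door arrow, I: the separating family and its measure (O28)

DOOR-ARROW STRICTNESS on the chasm axis (`11333 ⟹ BoundedDoor ⟹ WidthDoor ⟹ VP ≠ VNP`): the
arrow `Depth4BoundedDoor.boundedDoor_of_depth4HomFour` converts a homogeneous-`ΣΠΣΠ` CIRCUIT
lower bound into the absence of `ΣΠ^{[c⌊√n⌋+c]}ΣΠ^{[⌊√n⌋]}` EXPRESSIONS; this file and
`Depth4DoorStrictnessCircuit` show the conversion is ONE-WAY by an explicit homogeneous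
degree-`n` family `sepPoly K n = z^{n mod (2t+2)} · ∏_{j<B} ∑_{i<M} x_{j,i} y_{j,i}^{2t+1}`
(`t = ⌊√n⌋`, `B = ⌊n/(2t+2)⌋`, `M = 2^{t+⌊t/2⌋}`): a product-of-sparse-blocks VARIANT over
`N = 2·B·M+1 = 2^{Θ(√n)}` variables — NOT Kumar–Saraf's `P_{t,n}` / `Q_n` (`N = Θ(n²)`, fixed
exponent; cf. "The limits of depth reduction for arithmetic formulas", Thm. 2.3/2.4) and NOT a
p-family (FORCED: a p-family with the `BoundedDoor`-shape is outside VP, an explicit lower bound).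
HERE (expression currency): the family, its derivative operators `ops` (one `x` per block) and
CAPPED shifts (all `y`-exponents `≤ 2t`), `∂_{ops m} sepPoly = ` one monomial, the dimension
sandwich `M^B·|capped| ≤ dim(shifted partials) ≤ s·#{A ⊆ [D], |A| ≤ B}·#{|β| ≤ ℓ+B(t-1)}`
(GKKS 2014 Cor. 10 by name) and the cap count; the witness `n = 4^(2c+7)` and the circuit side
are in `Depth4DoorStrictnessCircuit`.  DEGENERATE ENDS: `n = 0` gives `sepPoly = 1` (`B = 0`,
`M = 1`), `n = 1` gives `sepPoly = z` with `ops = []` (all statements true and harmless there);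
no theorem here has an `∃ n` to witness.  HONEST LABELS: NOT a rung · 0 S-currency · closes no
item · NOT a p-family · VP ≠ VNP is NOT proved · for per both cells and the converse stay
UNDECIDED · KNOWN in spirit (Kumar–Saraf 2015; Gupta–Kamath–Kayal–Saptharishi 2014), kernel-new.
References: KumarSaraf2015, GuptaKamathKayalSaptharishi2014, Tavenas2015, KumarSaraf2017.
-/

set_option linter.dupNamespace false

namespace Summit.ValiantsHypothesis.ValiantsHypothesis.Theorems.Depth4DoorStrictness

open MvPolynomial Literature.Computability.AlgebraicComplexity
  Literature.Computability.AlgebraicComplexity.GKKS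

/-- Number of blocks `B(n) = ⌊n / (2⌊√n⌋ + 2)⌋`. [cite: KumarSaraf2015, cf. Thm. 2.4] -/
def blocks (n : ℕ) : ℕ := n / (2 * Nat.sqrt n + 2)

/-- Block width `M(n) = 2^(⌊√n⌋ + ⌊√n⌋/2)`. [cite: KumarSaraf2015, cf. Thm. 2.4] -/
def width (n : ℕ) : ℕ := 2 ^ (Nat.sqrt n + Nat.sqrt n / 2)

/-- Variables of `sepPoly n`: `x_{j,i} = inl (inl (j,i))`, `y_{j,i} = inl (inr (j,i))`
(`j < B(n)`, `i < M(n)`) and the padding variable `z = inr ()`.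
[cite: KumarSaraf2015, cf. Thm. 2.4] -/
abbrev Var (n : ℕ) : Type :=
  ((Fin (blocks n) × Fin (width n)) ⊕ (Fin (blocks n) × Fin (width n))) ⊕ Unit

/-- Exponent vectors of the family: `ev n b m = b·∑_j e_{x_{j,m_j}} + (2⌊√n⌋+1)·∑_j e_{y_{j,m_j}}
+ (n mod (2⌊√n⌋+2))·e_z` (`b = 1`: the monomials of `sepPoly`; `b = 0`: their `x`-free tails,
the values of the derivative operators). [cite: KumarSaraf2015, cf. Thm. 2.4] -/
noncomputable def ev (n b : ℕ) (m : Fin (blocks n) → Fin (width n)) : Var n →₀ ℕ :=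
  Finsupp.equivFunOnFinite.symm
    (Sum.elim (Sum.elim (fun p => if m p.1 = p.2 then b else 0)
      (fun p => if m p.1 = p.2 then 2 * Nat.sqrt n + 1 else 0))
      (fun _ => n % (2 * Nat.sqrt n + 2)))

/-- **The separating family** `g_n = z^{n mod (2t+2)} · ∏_{j<B} ∑_{i<M} x_{j,i} y_{j,i}^{2t+1}`
(`t = ⌊√n⌋`), written as the sum of its `M^B` monomials: a product-of-sparse-blocks VARIANT over
`2·B·M+1 = 2^{Θ(√n)}` variables, NOT Kumar–Saraf's `P_{t,n}` / `Q_n` (`Θ(n²)` variables, fixed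
exponent) and NOT a p-family. [cite: KumarSaraf2015, cf. Thm. 2.4] -/
noncomputable def sepPoly (K : Type*) [CommSemiring K] (n : ℕ) : MvPolynomial (Var n) K :=
  ∑ m : Fin (blocks n) → Fin (width n), monomial (ev n 1 m) 1

/-- The derivative operators `∂_{x_{0,m_0}} ⋯ ∂_{x_{B-1,m_{B-1}}}` (order `B`, one `x` per block).
[cite: GuptaKamathKayalSaptharishi2014, Def. 1] -/
def ops (n : ℕ) (m : Fin (blocks n) → Fin (width n)) : List (Var n) :=
  List.ofFn fun j => Sum.inl (Sum.inl (j, m j))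

/-- The CAPPED shift set: exponent vectors of degree `≤ ℓ` whose `y`-exponents are all `≤ 2⌊√n⌋`
(strictly below the `y`-exponent `2⌊√n⌋+1` of the tails, so that a shifted tail determines the
tail). [cite: GuptaKamathKayalSaptharishi2014, Lemma 14] -/
noncomputable def capped (n ℓ : ℕ) : Finset (Var n →₀ ℕ) :=
  (degLE (Var n) ℓ).filter fun γ => ∀ p : Fin (blocks n) × Fin (width n),
    γ (Sum.inl (Sum.inr p)) ≤ 2 * Nat.sqrt n

/-- Coordinates of `ev`. [folklore] -/
private theorem ev_apply (n b : ℕ) (m : Fin (blocks n) → Fin (width n)) (w : Var n) :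
    ev n b m w = Sum.elim (Sum.elim (fun p : Fin (blocks n) × Fin (width n) =>
      if m p.1 = p.2 then b else 0) (fun p => if m p.1 = p.2 then 2 * Nat.sqrt n + 1 else 0))
      (fun _ => n % (2 * Nat.sqrt n + 2)) w := by
  simp [ev]

/-- Coordinates of `∑_j (a·e_{x_{j,m_j}} + r·e_{y_{j,m_j}})`. [folklore] -/
private theorem sum_xy_apply {n : ℕ} (m : Fin (blocks n) → Fin (width n)) (a r : ℕ) (w : Var n) :
    (∑ j : Fin (blocks n), (Finsupp.single (Sum.inl (Sum.inl (j, m j)) : Var n) a +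
        Finsupp.single (Sum.inl (Sum.inr (j, m j)) : Var n) r)) w =
      Sum.elim (Sum.elim (fun p : Fin (blocks n) × Fin (width n) => if m p.1 = p.2 then a else 0)
        (fun p => if m p.1 = p.2 then r else 0)) (fun _ => 0) w := by
  rw [Finsupp.finsetSum_apply]
  rcases w with ((⟨j₀, i₀⟩ | ⟨j₀, i₀⟩) | u)
  · rw [Finset.sum_eq_single j₀ (fun j _ hj => by simp [hj]) (by simp)]
    simp [Finsupp.single_apply]
  · rw [Finset.sum_eq_single j₀ (fun j _ hj => by simp [hj]) (by simp)]
    simp [Finsupp.single_apply]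
  · simp

/-- `ev n 1 m = ∑_j (e_{x_{j,m_j}} + (2t+1) e_{y_{j,m_j}}) + (n mod (2t+2)) e_z`. [folklore] -/
private theorem ev_one_eq (n : ℕ) (m : Fin (blocks n) → Fin (width n)) :
    ev n 1 m = (∑ j : Fin (blocks n), (Finsupp.single (Sum.inl (Sum.inl (j, m j)) : Var n) 1 +
        Finsupp.single (Sum.inl (Sum.inr (j, m j)) : Var n) (2 * Nat.sqrt n + 1))) +
      Finsupp.single (Sum.inr () : Var n) (n % (2 * Nat.sqrt n + 2)) := by
  ext w
  rw [Finsupp.add_apply, sum_xy_apply, ev_apply]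
  rcases w with ((p | p) | ⟨⟩) <;> simp

/-- `ev n 1 m = ev n 0 m + (indicator of ops n m)`. [folklore] -/
private theorem ev_one_eq_ev_zero_add (n : ℕ) (m : Fin (blocks n) → Fin (width n)) :
    ev n 1 m = ev n 0 m + listInd (ops n m) := by
  have h : listInd (ops n m) = ∑ j : Fin (blocks n),
      ((Finsupp.single (Sum.inl (Sum.inl (j, m j)) : Var n) 1 +
        Finsupp.single (Sum.inl (Sum.inr (j, m j)) : Var n) 0)) := by
    rw [ops, listInd_ofFn]
    simp only [Finsupp.single_zero, add_zero]
  ext w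
  rw [Finsupp.add_apply, h, sum_xy_apply, ev_apply, ev_apply]
  rcases w with ((p | p) | ⟨⟩) <;> simp

/-- `|Var n| = 2·B·M + 1`. [folklore] -/
theorem card_var (n : ℕ) : Fintype.card (Var n) = 2 * (blocks n * width n) + 1 := by
  simp only [Var, Fintype.card_sum, Fintype.card_prod, Fintype.card_fin, Fintype.card_unit]
  ring

/-- Degree of the exponent vectors: `|ev n b m| = B·b + B·(2t+1) + n mod (2t+2)`. [folklore] -/
theorem degree_ev (n b : ℕ) (m : Fin (blocks n) → Fin (width n)) :
    (ev n b m).degree = blocks n * b + blocks n * (2 * Nat.sqrt n + 1) +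
      n % (2 * Nat.sqrt n + 2) := by
  have hblk : ∀ a : ℕ, (∑ p : Fin (blocks n) × Fin (width n),
      (if m p.1 = p.2 then a else 0)) = blocks n * a := fun a => by
    rw [Fintype.sum_prod_type]
    simp only [Finset.sum_ite_eq, Finset.mem_univ, ite_true, Finset.sum_const, Finset.card_univ,
      Fintype.card_fin, smul_eq_mul]
  rw [Finsupp.degree_eq_sum, Fintype.sum_sum_type, Fintype.sum_sum_type]
  simp only [Fintype.sum_unique, ev_apply, Sum.elim_inl, Sum.elim_inr, hblk]

/-- `sepPoly K n` is homogeneous of degree `n` (`B·(2t+2) + n mod (2t+2) = n`). [folklore] -/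
theorem sepPoly_isHomogeneous (K : Type*) [CommSemiring K] (n : ℕ) :
    (sepPoly K n).IsHomogeneous n := by
  unfold sepPoly
  refine IsHomogeneous.sum _ _ _ fun m _ => isHomogeneous_monomial _ ?_
  rw [degree_ev, mul_one]
  have h := Nat.div_add_mod n (2 * Nat.sqrt n + 2)
  unfold blocks
  calc n / (2 * Nat.sqrt n + 2) + n / (2 * Nat.sqrt n + 2) * (2 * Nat.sqrt n + 1) +
        n % (2 * Nat.sqrt n + 2)
      = (2 * Nat.sqrt n + 2) * (n / (2 * Nat.sqrt n + 2)) + n % (2 * Nat.sqrt n + 2) := by ring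
    _ = n := h

/-- **The product form of `sepPoly`**: `B+1` pieces — the blocks `∑_i x_{j,i} y_{j,i}^{2t+1}`
(homogeneous of degree `2t+2`, `M` monomials each) and the padding `z^{n mod (2t+2)}` — whose
product is `sepPoly`, all supports inside a set of `≤ B·M+1` monomials (consumed by both
currencies). [cite: KumarSaraf2015, cf. Thm. 2.4] -/
theorem exists_pieces (K : Type*) [CommSemiring K] (n : ℕ) :
    ∃ (Q : Fin (blocks n + 1) → MvPolynomial (Var n) K) (U : Finset (Var n →₀ ℕ)),
      (∏ j, Q j = sepPoly K n) ∧ (∀ j, ∃ d, d ≤ 2 * Nat.sqrt n + 2 ∧ (Q j).IsHomogeneous d) ∧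
      (∀ j, (Q j).support ⊆ U) ∧ U.card ≤ blocks n * width n + 1 := by
  classical
  obtain ⟨v, hv⟩ : ∃ v : Fin (blocks n) × Fin (width n) → (Var n →₀ ℕ), ∀ p, v p =
      Finsupp.single (Sum.inl (Sum.inl p) : Var n) 1 +
        Finsupp.single (Sum.inl (Sum.inr p) : Var n) (2 * Nat.sqrt n + 1) := ⟨_, fun _ => rfl⟩
  obtain ⟨ez, hez⟩ : ∃ ez : Var n →₀ ℕ,
      ez = Finsupp.single (Sum.inr () : Var n) (n % (2 * Nat.sqrt n + 2)) := ⟨_, rfl⟩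
  refine ⟨Fin.snoc (α := fun _ => MvPolynomial (Var n) K)
      (fun j => ∑ i : Fin (width n), monomial (v (j, i)) 1) (monomial ez 1),
    (Finset.univ.biUnion fun p : Fin (blocks n) × Fin (width n) => {v p}) ∪ {ez},
    ?_, fun j => ?_, fun j => ?_, ?_⟩
  · rw [Fin.prod_univ_castSucc]
    simp only [Fin.snoc_castSucc, Fin.snoc_last]
    rw [Fintype.prod_sum, Finset.sum_mul]
    unfold sepPoly
    refine Finset.sum_congr rfl fun m _ => ?_
    rw [← monomial_sum_one, monomial_mul, one_mul, ev_one_eq]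
    simp only [hv, hez]
  · induction j using Fin.lastCases with
    | last =>
      refine ⟨n % (2 * Nat.sqrt n + 2), (Nat.mod_lt _ (by omega)).le, ?_⟩
      rw [Fin.snoc_last, hez]
      exact isHomogeneous_monomial _ (Finsupp.degree_single _ _)
    | cast j =>
      refine ⟨1 + (2 * Nat.sqrt n + 1), by omega, ?_⟩
      rw [Fin.snoc_castSucc]
      exact IsHomogeneous.sum _ _ _ fun i _ => isHomogeneous_monomial _ (by
        rw [hv, map_add, Finsupp.degree_single, Finsupp.degree_single])
  · induction j using Fin.lastCases with
    | last =>
      rw [Fin.snoc_last]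
      exact support_monomial_subset.trans Finset.subset_union_right
    | cast j =>
      rw [Fin.snoc_castSucc]
      intro s hs
      obtain ⟨i, -, hi⟩ := Finset.mem_biUnion.1 (support_sum hs)
      rw [Finset.mem_singleton.1 (support_monomial_subset hi)]
      exact Finset.mem_union_left _
        (Finset.mem_biUnion.2 ⟨(j, i), Finset.mem_univ _, Finset.mem_singleton_self _⟩)
  · calc ((Finset.univ.biUnion fun p : Fin (blocks n) × Fin (width n) => {v p}) ∪ {ez}).card
        ≤ (∑ p : Fin (blocks n) × Fin (width n), ({v p} : Finset (Var n →₀ ℕ)).card) + 1 :=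
          (Finset.card_union_le _ _).trans (Nat.add_le_add Finset.card_biUnion_le (by simp))
      _ = blocks n * width n + 1 := by
          simp only [Finset.card_singleton, Finset.sum_const, Finset.card_univ, Fintype.card_prod,
            Fintype.card_fin, smul_eq_mul, mul_one]

/-- **Cheap side, expression currency**: `sepPoly` is ONE product of `B+1` polynomials of degree
`≤ 2⌊√n⌋+2` — a `ΣΠ^{[B+1]}ΣΠ^{[2⌊√n⌋+2]}` expression of top fan-in `1`, for every `n`.
[cite: KumarSaraf2015, cf. Thm. 2.4] -/
theorem hasSPSPExpr_sepPoly_coarse (K : Type*) [CommSemiring K] (n : ℕ) :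
    HasSPSPExpr (sepPoly K n) 1 (blocks n + 1) (2 * Nat.sqrt n + 2) := by
  obtain ⟨Q, U, hprod, hdeg, -, -⟩ := exists_pieces K n
  refine ⟨fun _ => Q, fun _ j => ?_, ?_⟩
  · obtain ⟨d, hd, hhom⟩ := hdeg j
    exact hhom.totalDegree_le.trans hd
  · show sepPoly K n = ∑ _i : Fin 1, ∏ j, Q j
    rw [Fin.sum_univ_one, hprod]

/-- **The derivative operators isolate single monomials**: `∂_{ops m} sepPoly = x^{ev n 0 m}`
(coefficient `1`, any characteristic). [cite: GuptaKamathKayalSaptharishi2014, §2] -/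
theorem iterPderiv_ops_sepPoly (K : Type*) [CommRing K] (n : ℕ)
    (m : Fin (blocks n) → Fin (width n)) :
    iterPderiv (ops n m) (sepPoly K n) = monomial (ev n 0 m) 1 := by
  classical
  have hnd : (ops n m).Nodup := by
    rw [ops, List.nodup_ofFn]
    intro j j' h
    simp only [Sum.inl.injEq, Prod.mk.injEq] at h
    exact h.1
  unfold sepPoly
  rw [map_sum, Finset.sum_eq_single m]
  · have hexp : ev n 1 m - listInd (ops n m) = ev n 0 m := by
      rw [ev_one_eq_ev_zero_add, add_tsub_cancel_right]
    have hcoef : (1 : K) * ((ops n m).map fun v => ((ev n 1 m v : ℕ) : K)).prod = 1 := by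
      rw [one_mul, ops, List.map_ofFn, List.prod_ofFn]
      exact Finset.prod_eq_one fun j _ => by simp [ev_apply]
    rw [iterPderiv_monomial _ hnd, hexp, hcoef]
  · intro m' _ hm'
    obtain ⟨j, hj⟩ := Function.ne_iff.1 hm'
    have h0 : (1 : K) * ((ops n m).map fun v => ((ev n 1 m' v : ℕ) : K)).prod = 0 := by
      rw [one_mul, ops, List.map_ofFn, List.prod_ofFn]
      exact Finset.prod_eq_zero (Finset.mem_univ j) (by simp [ev_apply, hj])
    rw [iterPderiv_monomial _ hnd, h0, monomial_zero]
  · exact fun h => absurd (Finset.mem_univ m) h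

/-- **Dimension lower bound**: the capped shifted tails `x^γ · ∂_{ops m} sepPoly`
(`m ∈ [M]^B`, `γ ∈ capped n ℓ`) are pairwise distinct monomials, so
`M^B · |capped n ℓ| ≤ dim ⟨shifted partials⟩`. [cite: GuptaKamathKayalSaptharishi2014, Cor. 16] -/
theorem width_pow_mul_card_capped_le_finrank (K : Type*) [Field K] (n ℓ : ℕ) :
    width n ^ blocks n * (capped n ℓ).card ≤
      Module.finrank K (shifted (ops n) ℓ (sepPoly K n)) := by
  classical
  obtain ⟨key, hkey⟩ : ∃ key : (Fin (blocks n) → Fin (width n)) × capped n ℓ → (Var n →₀ ℕ),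
      ∀ p, key p = (p.2 : Var n →₀ ℕ) + ev n 0 p.1 := ⟨_, fun _ => rfl⟩
  have hinj : Function.Injective key := by
    rintro ⟨m, γ, hγ⟩ ⟨m', γ', hγ'⟩ h
    rw [hkey, hkey] at h
    dsimp only at h
    have hcap' : ∀ p : Fin (blocks n) × Fin (width n),
        γ' (Sum.inl (Sum.inr p)) ≤ 2 * Nat.sqrt n := by
      have := hγ'
      simp only [capped, Finset.mem_filter] at this
      exact this.2
    have hm : m = m' := by
      funext j
      by_contra hne
      have h1 := congrArg (fun δ : Var n →₀ ℕ => δ (Sum.inl (Sum.inr (j, m j)))) h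
      have e1 : ev n 0 m (Sum.inl (Sum.inr (j, m j))) = 2 * Nat.sqrt n + 1 := by simp [ev_apply]
      have e2 : ev n 0 m' (Sum.inl (Sum.inr (j, m j))) = 0 := by simp [ev_apply, Ne.symm hne]
      simp only [Finsupp.add_apply, e1, e2] at h1
      have h2 := hcap' (j, m j)
      omega
    subst hm
    have hγγ : γ = γ' := add_left_injective _ h
    subst hγγ
    rfl
  have hli : LinearIndependent K (fun p => monomial (key p) (1 : K)) := by
    have h0 : LinearIndependent K (fun s : Var n →₀ ℕ => monomial s (1 : K)) := by
      have := (MvPolynomial.basisMonomials (Var n) K).linearIndependent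
      rwa [MvPolynomial.coe_basisMonomials] at this
    exact h0.comp _ hinj
  have hle : Submodule.span K (Set.range fun p => monomial (key p) (1 : K)) ≤
      shifted (ops n) ℓ (sepPoly K n) := by
    refine Submodule.span_le.mpr ?_
    rintro _ ⟨p, rfl⟩
    have hp : (p.2 : Var n →₀ ℕ) ∈ degLE (Var n) ℓ := by
      have := p.2.2
      simp only [capped, Finset.mem_filter] at this
      exact this.1
    refine Submodule.subset_span ⟨(p.1, ⟨(p.2 : Var n →₀ ℕ), hp⟩), ?_⟩
    show monomial (p.2 : Var n →₀ ℕ) 1 * iterPderiv (ops n p.1) (sepPoly K n) = monomial (key p) 1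
    rw [iterPderiv_ops_sepPoly, monomial_mul, one_mul, hkey]
  haveI : Module.Finite K (shifted (ops n) ℓ (sepPoly K n)) :=
    Module.Finite.span_of_finite K (Set.finite_range _)
  calc width n ^ blocks n * (capped n ℓ).card
      = Fintype.card ((Fin (blocks n) → Fin (width n)) × capped n ℓ) := by
        rw [Fintype.card_prod, Fintype.card_fun, Fintype.card_fin, Fintype.card_fin,
          Fintype.card_coe]
    _ = Module.finrank K (Submodule.span K (Set.range fun p => monomial (key p) (1 : K))) :=
        (finrank_span_eq_card hli).symm
    _ ≤ Module.finrank K (shifted (ops n) ℓ (sepPoly K n)) := Submodule.finrank_mono hle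

/-- **Counting the capped shifts**: all but at most `B·M·#{|γ'| ≤ ℓ-(2t+1)}` of the `#{|γ| ≤ ℓ}`
shifts are capped (an uncapped `γ` is `γ' + (2t+1)e_y` for some `y`). [folklore] -/
theorem card_degLE_le_card_capped_add (n ℓ : ℕ) :
    (degLE (Var n) ℓ).card ≤ (capped n ℓ).card +
      blocks n * width n * (degLE (Var n) (ℓ - (2 * Nat.sqrt n + 1))).card := by
  classical
  set r := 2 * Nat.sqrt n + 1 with hr
  obtain ⟨bad, hbad⟩ : ∃ bad : Finset (Var n →₀ ℕ), bad =
      (Finset.univ : Finset (Fin (blocks n) × Fin (width n))).biUnion fun p =>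
        (degLE (Var n) (ℓ - r)).image fun γ => γ + Finsupp.single (Sum.inl (Sum.inr p) : Var n) r :=
    ⟨_, rfl⟩
  have hcover : degLE (Var n) ℓ ⊆ capped n ℓ ∪ bad := by
    intro γ hγ
    by_cases hc : ∀ p : Fin (blocks n) × Fin (width n), γ (Sum.inl (Sum.inr p)) ≤ 2 * Nat.sqrt n
    · exact Finset.mem_union_left _ (Finset.mem_filter.2 ⟨hγ, hc⟩)
    · push Not at hc
      obtain ⟨p, hp⟩ := hc
      rw [hbad]
      refine Finset.mem_union_right _ (Finset.mem_biUnion.2 ⟨p, Finset.mem_univ _, ?_⟩)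
      have hle : Finsupp.single (Sum.inl (Sum.inr p) : Var n) r ≤ γ :=
        Finsupp.single_le_iff.2 (by omega)
      refine Finset.mem_image.2
        ⟨γ - Finsupp.single (Sum.inl (Sum.inr p) : Var n) r, ?_, tsub_add_cancel_of_le hle⟩
      have h1 : (γ - Finsupp.single (Sum.inl (Sum.inr p) : Var n) r).degree + r = γ.degree := by
        conv_rhs => rw [← tsub_add_cancel_of_le hle]
        rw [map_add, Finsupp.degree_single]
      have h2 := mem_degLE.1 hγ
      rw [mem_degLE]
      omega
  have hbadc : bad.card ≤ blocks n * width n * (degLE (Var n) (ℓ - r)).card := by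
    rw [hbad]
    calc _ ≤ ∑ p : Fin (blocks n) × Fin (width n), ((degLE (Var n) (ℓ - r)).image
            fun γ => γ + Finsupp.single (Sum.inl (Sum.inr p) : Var n) r).card :=
          Finset.card_biUnion_le
      _ ≤ ∑ _p : Fin (blocks n) × Fin (width n), (degLE (Var n) (ℓ - r)).card :=
          Finset.sum_le_sum fun p _ => Finset.card_image_le
      _ = blocks n * width n * (degLE (Var n) (ℓ - r)).card := by
          rw [Finset.sum_const, Finset.card_univ, Fintype.card_prod, Fintype.card_fin,
            Fintype.card_fin, smul_eq_mul]
  calc (degLE (Var n) ℓ).card ≤ (capped n ℓ ∪ bad).card := Finset.card_le_card hcover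
    _ ≤ (capped n ℓ).card + bad.card := Finset.card_union_le _ _
    _ ≤ (capped n ℓ).card + blocks n * width n * (degLE (Var n) (ℓ - r)).card :=
        Nat.add_le_add_left hbadc _

/-- **The measure inequality**: an `ΣΠ^{[D]}ΣΠ^{[t]}` expression of `sepPoly K n` with top
fan-in `s` forces `M^B · |capped n ℓ| ≤ s · #{A ⊆ [D] : |A| ≤ B} · #{|β| ≤ ℓ + B(t-1)}` for every
shift length `ℓ` (GKKS Cor. 10 upper bound `finrank_shifted_le` against the lower bound above).
[cite: GuptaKamathKayalSaptharishi2014, Cor. 10, Cor. 16] -/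
theorem width_pow_mul_le_of_hasSPSPExpr (K : Type*) [Field K] {n s D t : ℕ} (ℓ : ℕ)
    (h : HasSPSPExpr (sepPoly K n) s D t) :
    width n ^ blocks n * (capped n ℓ).card ≤
      s * numSubsetsLE D (blocks n) * (degLE (Var n) (ℓ + blocks n * (t - 1))).card := by
  classical
  obtain ⟨Q, hQ, hf⟩ := h
  have hup := finrank_shifted_le (K := K) (ℓ := ℓ) (ops n) (blocks n) (fun m => by simp [ops]) Q hQ
  rw [← hf] at hup
  exact (width_pow_mul_card_capped_le_finrank K n ℓ).trans hup

end Summit.ValiantsHypothesis.ValiantsHypothesis.Theorems.Depth4DoorStrictness
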